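/-
Copyright (c) 2026 the pub-hodgecm-mathlib formalisation cell (harness21).  Prover seat hodgecm-mathlib-K2E5-p10 (g2),
Track B «K2-LIT» ∕ h413 (stmt-HodgeConjecture-24833), engine E5 «TamagawaUnitary», unit G organ (O6) FILE B (defs):
the splitting of the image torus on the (O3)∕(23) carriers, THE SQUARE with the ranged reduced norms, and the h-FREE BASE MEASURES
`ν_∞ = (⊗_w τ_w)|_{im_∞(h)}`, `ν_f = Haar(𝒪̂^×_{L⁺}) = 1` of the G13 head.  2026-09-04.
-/
import Summits.HodgeConjecture.HodgeConjecture.Theorems.K2E5QuatNrdImageSplitting            -- ★ (O6) FILE A′ (this seat): `archNrdImage`, `quatNrdImageSplitEquiv`, `fixedIdeleSplitEquiv_nrd`; brings FILE A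
import Summits.HodgeConjecture.HodgeConjecture.Theorems.K2E5QuatArchNrdDefs                   -- ★ (O3) (K2E5-p04 (g2), p856278): `quatArchNrdPi`
import Summits.HodgeConjecture.HodgeConjecture.Theorems.K2E5QuatFinPinnedEqSmulProductOfPin    -- ★ (K2E5-p17 (g2)): `isOpen_baseLevel`, `isCompact_baseLevel`, `fixedFinIntUnits_eq_inf`; brings ★ `fixedFinIntUnits`, ★ (23) `quatFinNrdImage`∕`quatFinNrdToImage`
import Summits.HodgeConjecture.HodgeConjecture.Theorems.K2E5QuatUnitsBetaExists                -- ★ (K2E5-p12): `isOpen_quatNrdImage`, `isHaarMeasure_quatNrdImageMeasure`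
import Summits.HodgeConjecture.HodgeConjecture.Theorems.K2E5QuatNrdImageLattice               -- ★ (K2E5-p08): `locallyCompactSpace_quatNrdImage`, `secondCountableTopology_quatNrdImage`, `isClosed_quatNrdImage`
import HarnessLib

/-!
# K2_E5 road (h413 = stmt-HodgeConjecture-24833), unit G organ (O6), FILE B: `Ψ_h`, THE SQUARE, and the base measures `ν_∞(h)`, `ν_f(h)`

Cell `pub/hodgecm-mathlib` (D-0151), Track B; dealer K2E5-plan (g2), SWEEP #15 (2026-09-04T00:44:41Z) «(O6) ↦ K2E5-p10 (g2)»; consumer letters = K2E5-p17 (g2)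
«(31) HEAD INTERFACE» (00:55:00Z): «`Ψ_h : ↥(quatArchNrdImage L Ha hdet) × ↥(quatFinNrdImage L Ha) ≃ₜ* ↥(quatNrdImage L Ha)` (on p04's `quatArchNrdImage`, file 2 of (O3), so both organs
name ONE arch image), the square `hsq : ∀ p, quatAdelicNrdToImage L Ha hdet ((quatAdelicProdEquiv L Ha).symm p) = Ψ_h (quatArchNrdToImage L Ha hdet p.1, quatFinNrdToImage L Ha p.2)`,
the two base measures `ν_∞(h)` (restriction of the h-FREE `ι_∞⁰ := Measure.pi (w ↦ τ_w)`) and `ν_f(h)` (restriction of the h-free `ι_f⁰`, so that G13-fin's `hν₁ : ν_f(h) (𝒪̂^×_{L⁺}) = 1`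
holds BY NAME), both `IsHaarMeasure`».  Here (O3) file 2 is not ★ yet, so `quatArchNrdImage L Ha hdet` is written as its BODY `(quatArchNrdPi L Ha hdet).range` (★ p856278) and
`quatArchNrdToImage` as `(quatArchNrdPi L Ha hdet).rangeRestrict` — definitionally the frozen names of K2E5-p04 (g2)'s REPORT-FIRST (00:49:46Z).

* §1 BRIDGES: `range_quatArchNrdPi_eq_archNrdImage : (quatArchNrdPi L Ha hdet).range = archNrdImage L Ha hdet` (★ FILE A′; the arch places are independent, ★ `quatArchPiEquiv`),
  `quatFinNrdImage_eq_fixedFinAdelicUnits` (★ (23) ED.2), the carrier identifications `archImageCongr`, `finImageCongr` (`MulEquiv.subgroupCongr`, bicontinuous), and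
  **`quatNrdImageSplitEquivPi L Ha hHa hdet : ↥((quatArchNrdPi L Ha hdet).range) × ↥(quatFinNrdImage L Ha) ≃ₜ* ↥(quatNrdImage L Ha)`** (= p17's `Ψ_h`; `coe_coe_…_apply`).
* §2 **THE SQUARE** `quatAdelicNrdToImage_prodEquiv_symm : quatAdelicNrdToImage L Ha hdet ((quatAdelicProdEquiv L Ha).symm p) =
  quatNrdImageSplitEquivPi … ((quatArchNrdPi L Ha hdet).rangeRestrict p.1, quatFinNrdToImage L Ha p.2)` (= p17's `hsq`; from ★ FILE A′ `fixedIdeleSplitEquiv_nrd`).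
* §3 BASE MEASURES (generic `[MeasurableSpace ℝˣ] [BorelSpace ℝˣ]`, `[MeasurableSpace ↥(quatFinNrdImage L Ha)] [BorelSpace …]` binders, as the consumer asked):
  **`archBaseMeasure τ A := (Measure.pi τ).comap Subtype.val : Measure ↥A`** for ANY subgroup `A ≤ (W → ℝˣ)` (`ν_∞(h) = archBaseMeasure τ (quatArchNrdImage L Ha hdet)`), Haar when `A` is open
  (`isHaarMeasure_archBaseMeasure`, Mathlib `IsHaarMeasure.comap`); **`finBaseLevel`** (★ p17's base level `𝒪̂^×_{L⁺} ∩ Nrd_f(…)` as `PositiveCompacts`, ★ `isCompact_baseLevel`∕`isOpen_baseLevel`),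
  **`finBaseMeasure L Ha hHa hdet := haarMeasure (finBaseLevel …)`** with **`finBaseMeasure_baseLevel : … = 1`** (= `hν₁` BY NAME), `isHaarMeasure_finBaseMeasure`, `locallyCompactSpace_quatFinNrdImage`.
The comparison `quatNrdImageMeasure L ι = c(ι) • map Ψ_h (ν_∞(h) ⊗ ν_f(h))` with `c(ι)` h-FREE is FILE B′ `K2E5FixedIdeleBaseComparisonHead`.

[cite: VignerasLNM800, Ch. III §1–§2 (n_A, n(H_A^×), mesures sur K_A^×)] [cite: WeilBNT1967, Ch. IV §4 (k_A^× = k_∞^× × k_f^×, ∏ r_v^×)] [cite: BorelJacquet1979, §4.1] [cite: CasselsFrohlichANT1967, Ch. II §14–§16]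

HONEST LABEL: HC_CM is proved only modulo the 7 printed citations (2 remaining named inputs: hLiu418 = stmt-HodgeConjecture-24832,
h413 = stmt-HodgeConjecture-24833) until rung 0 closes; this file is a `--supports stmt-HodgeConjecture-24833 --as helper` defs leaf and retires nothing by itself.
-/

set_option autoImplicit false
set_option linter.dupNamespace false   -- `Summit.HodgeConjecture.HodgeConjecture.…` (D-0017 nested layout; lakefile exemption for Summits)

noncomputable section

namespace Summit.HodgeConjecture.HodgeConjecture.Cruxes.H413.K2E5FixedIdeleBaseComparison

open MeasureTheory Measure NumberField NumberField.InfinitePlace IsDedekindDomain Topology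
open Literature.NumberTheory.Automorphic Literature.NumberTheory.Automorphic.UnitaryGroup
open Summit.HodgeConjecture.HodgeConjecture.Cruxes.H413.K2E5QuatAdelicMatrixModel
open Summit.HodgeConjecture.HodgeConjecture.Cruxes.H413.K2E5QuatAdelicNrd
open Summit.HodgeConjecture.HodgeConjecture.Cruxes.H413.K2E5QuatAdelicMeasure
open Summit.HodgeConjecture.HodgeConjecture.Cruxes.H413.K2E5QuatAdelicRestrictedProduct
open Summit.HodgeConjecture.HodgeConjecture.Cruxes.H413.K2E5QuatAdelicProdDecomposition
open Summit.HodgeConjecture.HodgeConjecture.Cruxes.H413.K2E5QuatFinNrd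
open Summit.HodgeConjecture.HodgeConjecture.Cruxes.H413.K2E5QuatFinNrdSurjective
open Summit.HodgeConjecture.HodgeConjecture.Cruxes.H413.K2E5QuatFinNrdLevelIndexFactorization (fixedFinIntUnits)
open Summit.HodgeConjecture.HodgeConjecture.Cruxes.H413.K2E5QuatFinPinnedEqSmulProductOfPin (isOpen_baseLevel isCompact_baseLevel)
open Summit.HodgeConjecture.HodgeConjecture.Cruxes.H413.K2E5QuatArchLocal
open Summit.HodgeConjecture.HodgeConjecture.Cruxes.H413.K2E5QuatArchPlaces
open Summit.HodgeConjecture.HodgeConjecture.Cruxes.H413.K2E5QuatArchNrd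
open Summit.HodgeConjecture.HodgeConjecture.Cruxes.H413.K2E5FixedIdeleBaseSplitting
open Summit.HodgeConjecture.HodgeConjecture.Cruxes.H413.K2E5QuatNrdImageSplitting
open scoped Matrix MatrixGroups ENNReal NNReal Classical

variable (L : Type) [Field L] [NumberField L] [IsCMField L] (Ha : Matrix (Fin 2) (Fin 2) L)
  (hHa : (Ha.map (cmConjRingHom L)).transpose = Ha) (hdet : Ha.det ≠ 0)

/-! ## §1 Bridges to the (O3)∕(23) carriers and `Ψ_h` -/

/-- **`range Nrd_∞ = im_∞(h) = Π_w range Nrd_w`**: the arch places are independent (★ `quatArchPiEquiv`), so the range of ★ (O3) `quatArchNrdPi` (= p04's `quatArchNrdImage`, by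
definition) IS ★ FILE A′'s `archNrdImage`. [cite: VignerasLNM800, Ch. III §2] [cite: BorelJacquet1979, §4.1] -/
theorem range_quatArchNrdPi_eq_archNrdImage : (quatArchNrdPi L Ha hdet).range = archNrdImage L Ha hdet := by
  refine le_antisymm ?_ fun r hr => ?_
  · rintro _ ⟨g, rfl⟩
    exact (mem_archNrdImage_iff L Ha hdet _).2 fun w => ⟨quatArchAt L Ha w g, rfl⟩
  · choose g hg using (mem_archNrdImage_iff L Ha hdet r).1 hr
    refine ⟨(quatArchPiEquiv L Ha).symm g, funext fun w => ?_⟩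
    rw [quatArchNrdPi_apply_eq_quatArchPiEquiv, ContinuousMulEquiv.apply_symm_apply, hg w]

include hHa hdet in
/-- `im_f = (𝔸_{L⁺,f})^×`: ★ (23) `quatFinNrdImage L Ha` (the range of `Nrd_f`) is ALL of ★ `fixedFinAdelicUnits L` (★ `range_quatFinNrd_eq_fixedFinAdelicUnits`).
[cite: VignerasLNM800, Ch. II §1 Lemme 1.4; Ch. III §1] -/
theorem quatFinNrdImage_eq_fixedFinAdelicUnits : quatFinNrdImage L Ha = fixedFinAdelicUnits L :=
  range_quatFinNrd_eq_fixedFinAdelicUnits L Ha hHa hdet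

/-- The carrier identification `↥(range Nrd_∞) ≃ₜ* ↥(im_∞(h))` (identity on values). [folklore] -/
def archImageCongr : ↥((quatArchNrdPi L Ha hdet).range) ≃ₜ* ↥(archNrdImage L Ha hdet) :=
  { MulEquiv.subgroupCongr (range_quatArchNrdPi_eq_archNrdImage L Ha hdet) with
    continuous_toFun := continuous_induced_rng.2 continuous_subtype_val
    continuous_invFun := continuous_induced_rng.2 continuous_subtype_val }

/-- `archImageCongr` is the identity on values. [folklore] -/
@[simp] theorem coe_archImageCongr (a : ↥((quatArchNrdPi L Ha hdet).range)) :
    ((archImageCongr L Ha hdet a : ↥(archNrdImage L Ha hdet)) : {w : InfinitePlace L // IsComplex w} → ℝˣ) = (a : {w : InfinitePlace L // IsComplex w} → ℝˣ) :=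
  rfl

/-- The carrier identification `↥(quatFinNrdImage) ≃ₜ* ↥(fixedFinAdelicUnits)` (identity on values). [folklore] -/
def finImageCongr : ↥(quatFinNrdImage L Ha) ≃ₜ* ↥(fixedFinAdelicUnits L) :=
  { MulEquiv.subgroupCongr (quatFinNrdImage_eq_fixedFinAdelicUnits L Ha hHa hdet) with
    continuous_toFun := continuous_induced_rng.2 continuous_subtype_val
    continuous_invFun := continuous_induced_rng.2 continuous_subtype_val }

/-- `finImageCongr` is the identity on values. [folklore] -/
@[simp] theorem coe_finImageCongr (t : ↥(quatFinNrdImage L Ha)) :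
    ((finImageCongr L Ha hHa hdet t : ↥(fixedFinAdelicUnits L)) : (FiniteAdeleRing (𝓞 L) L)ˣ) = (t : (FiniteAdeleRing (𝓞 L) L)ˣ) :=
  rfl

/-- `finImageCongr.symm` is the identity on values. [folklore] -/
@[simp] theorem coe_finImageCongr_symm (t : ↥(fixedFinAdelicUnits L)) :
    (((finImageCongr L Ha hHa hdet).symm t : ↥(quatFinNrdImage L Ha)) : (FiniteAdeleRing (𝓞 L) L)ˣ) = (t : (FiniteAdeleRing (𝓞 L) L)ˣ) :=
  rfl

/-- The product of the two carrier identifications, as a topological-group isomorphism. [folklore] -/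
def imageProdCongr :
    (↥((quatArchNrdPi L Ha hdet).range) × ↥(quatFinNrdImage L Ha)) ≃ₜ* (↥(archNrdImage L Ha hdet) × ↥(fixedFinAdelicUnits L)) :=
  { (archImageCongr L Ha hdet).toMulEquiv.prodCongr (finImageCongr L Ha hHa hdet).toMulEquiv with
    continuous_toFun := ((archImageCongr L Ha hdet).continuous.comp continuous_fst).prodMk ((finImageCongr L Ha hHa hdet).continuous.comp continuous_snd)
    continuous_invFun := ((archImageCongr L Ha hdet).symm.continuous.comp continuous_fst).prodMk
      ((finImageCongr L Ha hHa hdet).symm.continuous.comp continuous_snd) }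

/-- **`Ψ_h = quatNrdImageSplitEquivPi : ↥(range Nrd_∞) × ↥(quatFinNrdImage) ≃ₜ* ↥(quatNrdImage)`** — ★ FILE A′'s `quatNrdImageSplitEquiv` on the (O3)∕(23) carriers (p04's
`quatArchNrdImage L Ha hdet := (quatArchNrdPi L Ha hdet).range` unfolds to the first factor). [cite: VignerasLNM800, Ch. III §2] [cite: BorelJacquet1979, §4.1] -/
def quatNrdImageSplitEquivPi : (↥((quatArchNrdPi L Ha hdet).range) × ↥(quatFinNrdImage L Ha)) ≃ₜ* ↥(quatNrdImage L Ha) :=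
  (imageProdCongr L Ha hHa hdet).trans (quatNrdImageSplitEquiv L Ha hdet hHa)

/-- Underlying idèle of `Ψ_h (a, t)`: `ideleOfArchFin (a, t)`. [folklore] -/
@[simp] theorem coe_coe_quatNrdImageSplitEquivPi_apply (p : ↥((quatArchNrdPi L Ha hdet).range) × ↥(quatFinNrdImage L Ha)) :
    (((quatNrdImageSplitEquivPi L Ha hHa hdet p : ↥(quatNrdImage L Ha)) : ↥(fixedAdelicUnits L)) : (AdeleRing (𝓞 L) L)ˣ) =
      ideleOfArchFin L ((p.1 : {w : InfinitePlace L // IsComplex w} → ℝˣ), (p.2 : (FiniteAdeleRing (𝓞 L) L)ˣ)) :=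
  rfl

/-- `Ψ_h (a, t)` as a fixed idèle: `fixedIdeleSplitEquiv (a, t)`. [folklore] -/
theorem coe_quatNrdImageSplitEquivPi_apply (p : ↥((quatArchNrdPi L Ha hdet).range) × ↥(quatFinNrdImage L Ha)) :
    ((quatNrdImageSplitEquivPi L Ha hHa hdet p : ↥(quatNrdImage L Ha)) : ↥(fixedAdelicUnits L)) =
      fixedIdeleSplitEquiv L ((p.1 : {w : InfinitePlace L // IsComplex w} → ℝˣ), (finImageCongr L Ha hHa hdet p.2 : ↥(fixedFinAdelicUnits L))) :=
  rfl

/-! ## §2 THE SQUARE: `Nrd ∘ (prodEquiv)⁻¹ = Ψ_h ∘ (Nrd_∞ × Nrd_f)` -/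

/-- **THE SQUARE (p17's `hsq`)**: for `p = (g_∞, g_f)`, the ranged reduced norm of `(g_∞, g_f) ∈ (D_h ⊗ 𝔸)^×` is `Ψ_h` of the pair of ranged reduced norms
`(Nrd_∞ g_∞, Nrd_f g_f)` — ★ FILE A′ `fixedIdeleSplitEquiv_nrd` read through `quatAdelicProdEquiv` (`quatArchPart ∘ prodEquiv⁻¹ = fst`, `quatFinPart ∘ prodEquiv⁻¹ = snd`).
[cite: VignerasLNM800, Ch. III §1 (n_A = (n_v)_v)] [cite: BorelJacquet1979, §4.1] -/
theorem quatAdelicNrdToImage_prodEquiv_symm (p : ↥(quatArchUnits L Ha) × ↥(quatFinAdelicUnits L Ha)) :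
    quatAdelicNrdToImage L Ha hdet ((quatAdelicProdEquiv L Ha).symm p) =
      quatNrdImageSplitEquivPi L Ha hHa hdet ((quatArchNrdPi L Ha hdet).rangeRestrict p.1, quatFinNrdToImage L Ha p.2) := by
  set x := (quatAdelicProdEquiv L Ha).symm p with hx
  have hparts : quatAdelicProdEquiv L Ha x = p := by rw [hx, ContinuousMulEquiv.apply_symm_apply]
  have h1 : quatArchPart L Ha x = p.1 := by have h := congrArg Prod.fst hparts; rwa [quatAdelicProdEquiv_apply] at h
  have h2 : quatFinPart L Ha x = p.2 := by have h := congrArg Prod.snd hparts; rwa [quatAdelicProdEquiv_apply] at h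
  refine Subtype.ext (Subtype.ext ?_)
  rw [coe_quatAdelicNrdToImage, coe_coe_quatNrdImageSplitEquivPi_apply]
  have key := congrArg (fun u : ↥(fixedAdelicUnits L) => (u : (AdeleRing (𝓞 L) L)ˣ)) (fixedIdeleSplitEquiv_nrd L Ha hdet x)
  simp only [coe_fixedIdeleSplitEquiv_apply] at key
  rw [← key, h1, h2]
  rfl

/-- THE SQUARE, pointwise-on-`x` form: `Nrd x = Ψ_h (Nrd_∞ x_∞, Nrd_f x_f)` with `(x_∞, x_f) = quatAdelicProdEquiv x`. [cite: VignerasLNM800, Ch. III §1] -/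
theorem quatAdelicNrdToImage_eq_quatNrdImageSplitEquivPi (x : ↥(quatAdelicUnits L Ha)) :
    quatAdelicNrdToImage L Ha hdet x =
      quatNrdImageSplitEquivPi L Ha hHa hdet ((quatArchNrdPi L Ha hdet).rangeRestrict (quatArchPart L Ha x), quatFinNrdToImage L Ha (quatFinPart L Ha x)) := by
  have h := quatAdelicNrdToImage_prodEquiv_symm L Ha hHa hdet (quatAdelicProdEquiv L Ha x)
  rwa [ContinuousMulEquiv.symm_apply_apply, quatAdelicProdEquiv_apply] at h

/-! ## §3 The h-free base measures: `ν_∞(h) = (⊗_w τ_w)|_{im_∞(h)}` and `ν_f(h)` normalised by `ν_f(𝒪̂^×_{L⁺}) = 1` -/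

section ArchMeasure

omit [IsCMField L] in
/-- `ℝˣ` is second countable (embedding `ℝˣ ↪ ℝ × ℝᵐᵒᵖ`). [folklore] -/
theorem secondCountableTopology_units_real : SecondCountableTopology ℝˣ :=
  Units.isEmbedding_embedProduct.secondCountableTopology

variable [MeasurableSpace ℝˣ]

/-- **`ν_∞ = archBaseMeasure τ A := (⊗_w τ_w)|_A`** — the product of the per-place Haar measures `τ_w` on `ℝˣ` (the (O5) letters use `τ_w = dt∕|t|`) restricted (`Measure.comap` along the
inclusion) to a subgroup `A ≤ (W → ℝˣ)`; the consumers take `A := quatArchNrdImage L Ha hdet` (open, (O3b)).  `h` enters ONLY through `A`; `W → ℝˣ` carries `MeasurableSpace.pi`.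
[cite: WeilBNT1967, Ch. IV §4] [cite: VignerasLNM800, Ch. III §2] -/
def archBaseMeasure (τ : {w : InfinitePlace L // IsComplex w} → Measure ℝˣ) (A : Subgroup ({w : InfinitePlace L // IsComplex w} → ℝˣ)) : Measure ↥A :=
  (Measure.pi τ).comap (Subtype.val : ↥A → ({w : InfinitePlace L // IsComplex w} → ℝˣ))

omit [IsCMField L] in
/-- Unfolding of `archBaseMeasure`. [folklore] -/
theorem archBaseMeasure_def (τ : {w : InfinitePlace L // IsComplex w} → Measure ℝˣ) (A : Subgroup ({w : InfinitePlace L // IsComplex w} → ℝˣ)) :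
    archBaseMeasure L τ A = (Measure.pi τ).comap (Subtype.val : ↥A → ({w : InfinitePlace L // IsComplex w} → ℝˣ)) := rfl

variable [BorelSpace ℝˣ]

omit [IsCMField L] in
/-- `W → ℝˣ` is a Borel space for the product σ-algebra (finite index, `ℝˣ` second countable). [folklore] -/
theorem borelSpace_pi_units : BorelSpace ({w : InfinitePlace L // IsComplex w} → ℝˣ) := by
  haveI := secondCountableTopology_units_real
  exact Pi.borelSpace

omit [IsCMField L] in
/-- On an OPEN subgroup the restricted measure evaluates as `ν_∞(S) = (⊗_w τ_w)(↑S)`. [folklore] -/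
theorem archBaseMeasure_apply (τ : {w : InfinitePlace L // IsComplex w} → Measure ℝˣ) {A : Subgroup ({w : InfinitePlace L // IsComplex w} → ℝˣ)}
    (hA : IsOpen (A : Set ({w : InfinitePlace L // IsComplex w} → ℝˣ))) (S : Set ↥A) :
    archBaseMeasure L τ A S = Measure.pi τ (Subtype.val '' S) := by
  haveI := borelSpace_pi_units L
  rw [archBaseMeasure_def]
  exact (MeasurableEmbedding.subtype_coe hA.measurableSet).comap_apply _ _

omit [IsCMField L] in
/-- A finite product of Haar measures on `ℝˣ` is a Haar measure on `W → ℝˣ` (Mathlib `Measure.pi.isHaarMeasure`; σ-finiteness from second countability). [folklore] -/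
theorem isHaarMeasure_pi_units (τ : {w : InfinitePlace L // IsComplex w} → Measure ℝˣ) [∀ w, (τ w).IsHaarMeasure] : (Measure.pi τ).IsHaarMeasure := by
  haveI := secondCountableTopology_units_real
  haveI := borelSpace_pi_units L
  infer_instance

omit [IsCMField L] in
/-- **`ν_∞` is a Haar measure** when each `τ_w` is and `A` is open (Mathlib `IsHaarMeasure.comap` along the open embedding of an open subgroup). [cite: WeilBNT1967, Ch. IV §4] -/
theorem isHaarMeasure_archBaseMeasure (τ : {w : InfinitePlace L // IsComplex w} → Measure ℝˣ) [∀ w, (τ w).IsHaarMeasure]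
    {A : Subgroup ({w : InfinitePlace L // IsComplex w} → ℝˣ)} (hA : IsOpen (A : Set ({w : InfinitePlace L // IsComplex w} → ℝˣ))) :
    (archBaseMeasure L τ A).IsHaarMeasure := by
  haveI := borelSpace_pi_units L
  haveI := isHaarMeasure_pi_units L τ
  rw [archBaseMeasure_def]
  exact IsHaarMeasure.comap (mH := inferInstance) (Measure.pi τ) (f := A.subtype) hA.isOpenEmbedding_subtypeVal

end ArchMeasure

section FinMeasure

/-- **The finite base level `𝒪̂^×_{L⁺} ∩ Nrd_f(…)` as a positive compact** of `↥(quatFinNrdImage L Ha)` (★ p17 `isCompact_baseLevel`, `isOpen_baseLevel`; it contains `1`).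
[cite: WeilBNT1967, Ch. IV §4 (∏ r_v^× compact open)] [cite: CasselsFrohlichANT1967, Ch. II §16] -/
def finBaseLevel : TopologicalSpace.PositiveCompacts ↥(quatFinNrdImage L Ha) where
  carrier := (((fixedFinIntUnits L).subgroupOf (quatFinNrdImage L Ha) : Subgroup ↥(quatFinNrdImage L Ha)) : Set ↥(quatFinNrdImage L Ha))
  isCompact' := isCompact_baseLevel L Ha hHa hdet
  interior_nonempty' := by
    rw [(isOpen_baseLevel L Ha hdet).interior_eq]
    exact ⟨1, Subgroup.one_mem _⟩

/-- The carrier of `finBaseLevel` is the base level. [folklore] -/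
@[simp] theorem coe_finBaseLevel :
    ((finBaseLevel L Ha hHa hdet : TopologicalSpace.PositiveCompacts ↥(quatFinNrdImage L Ha)) : Set ↥(quatFinNrdImage L Ha)) =
      (((fixedFinIntUnits L).subgroupOf (quatFinNrdImage L Ha) : Subgroup ↥(quatFinNrdImage L Ha)) : Set ↥(quatFinNrdImage L Ha)) :=
  rfl

include hHa hdet in
/-- `↥(quatFinNrdImage L Ha) = (𝔸_{L⁺,f})^×` is locally compact (it has the compact open subgroup `𝒪̂^×_{L⁺}`, Mathlib `PositiveCompacts.locallyCompactSpace_of_group`).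
[cite: WeilBNT1967, Ch. IV §4] -/
theorem locallyCompactSpace_quatFinNrdImage : LocallyCompactSpace ↥(quatFinNrdImage L Ha) :=
  (finBaseLevel L Ha hHa hdet).locallyCompactSpace_of_group

variable [MeasurableSpace ↥(quatFinNrdImage L Ha)] [BorelSpace ↥(quatFinNrdImage L Ha)]

/-- **`ν_f = finBaseMeasure`** — THE Haar measure on `↥(quatFinNrdImage L Ha) = (𝔸_{L⁺,f})^×` giving the compact open `𝒪̂^×_{L⁺}` mass `1` (Mathlib `haarMeasure` of `finBaseLevel`); h-free as a
measure on the h-free set `(𝔸_{L⁺,f})^×` (★ `quatFinNrdImage_eq_fixedFinAdelicUnits`). [cite: WeilBNT1967, Ch. IV §4; Ch. V §4 (vol(∏ r_v^×) = 1 normalisation)] [cite: VignerasLNM800, Ch. III §2] -/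
def finBaseMeasure : Measure ↥(quatFinNrdImage L Ha) :=
  haarMeasure (finBaseLevel L Ha hHa hdet)

/-- **`ν_f(𝒪̂^×_{L⁺}) = 1`** — G13-fin's `hν₁` BY NAME (Mathlib `haarMeasure_self`). [cite: WeilBNT1967, Ch. V §4] -/
theorem finBaseMeasure_baseLevel :
    finBaseMeasure L Ha hHa hdet (((fixedFinIntUnits L).subgroupOf (quatFinNrdImage L Ha) : Subgroup ↥(quatFinNrdImage L Ha)) : Set ↥(quatFinNrdImage L Ha)) = 1 := by
  rw [finBaseMeasure, ← coe_finBaseLevel L Ha hHa hdet, haarMeasure_self]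

/-- `ν_f` is a Haar measure. [cite: WeilBNT1967, Ch. IV §4] -/
theorem isHaarMeasure_finBaseMeasure : (finBaseMeasure L Ha hHa hdet).IsHaarMeasure := by
  haveI := locallyCompactSpace_quatFinNrdImage L Ha hHa hdet
  exact isHaarMeasure_haarMeasure (finBaseLevel L Ha hHa hdet)

end FinMeasure

end Summit.HodgeConjecture.HodgeConjecture.Cruxes.H413.K2E5FixedIdeleBaseComparison

end
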